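/-
Copyright: statement-level skeleton of a published paper (lit-balaban cell, Phase-2 proof seat p32 gen 42). No claims beyond
what the kernel checks below.
-/
import Literature.MathematicalPhysics.QuantumFieldTheory.Balaban1983to89.B3OnePIChainGlueLevels
import Literature.MathematicalPhysics.QuantumFieldTheory.Balaban1983to89.B3OnePIChainGlue

/-!
# B3 — T. Bałaban, *(Higgs)₂,₃ quantum fields in a finite volume. III. Renormalization*, CMP **88** (1983) 411–445
[Balaban1983Higgs3] — p. 416 [PDF 6] (1.21): A CHAIN OF `r + 1` CONNECTED INSERTIONS HAS `r` MORE SEPARATING LINES THAN ITS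
PIECES — for p37's list-recursive chains `B3OnePIChainGlue.chain T l` the number of lines separating the in-leg from the out-leg is
`Σ (pieces) + l.length`; a chain of PROPER insertions (no line of a piece separates its ports) has exactly `l.length` separating
lines: the `n = r + 1` term `C₀K₁C₀⋯C₀K_{r+1}C₀` of (1.21) read back from the glued graph

statement-level skeleton of published theorems with citation tags; proofs where landed; nothing here is a claim about
the Yang–Mills mass gap

PDF held: `paper:balaban1983-higgs-2-3-quantum-fields-finite-volume` (journal page = PDF page + 410); p. 416 L13–18 re-read this
session.

CITATION HEADER (lean-in-tree rule).  lit-balaban TYPED SKELETON (HOME `run/shared/lean/pub/lit-balaban/`), PHASE 2, seat p32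
gen 42 (unit `lit-balaban-p32`), row **B3.Eq1.19-1.22** of `HOME/lit-balaban-r15/ROWS-B3.md` (fold owner r15, referee ref-4; head
`proved` under the lead g12 HEAD WORD Q25, reading (P); OPTIONAL located member, zero head weight).  Composition BY NAME of
`B3OnePIChainGlueLevels.numSep_glue` (same seat) with p37 g106's `B3OnePIChainGlue.TwoLegGraph`/`glue2`/`chain`/`isConnected_chain`
and `B3OnePIChainPieces.isProper_iff_numSep_eq_zero`; nothing re-declared, no definition added.

THE PRINTED TEXT (verbatim).  p. 416: *"G^ε = Σ_{n=0}^∞ C₀^ε[(−δm² + Σ^ε + ∂^{ε*}Σ₁^ε + Σ₁^{ε*}∂^ε + ∂^{ε*}Σ₂^ε∂^ε)C₀^ε]ⁿ, (1.21)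
where C₀^ε = (−Δ₀^ε + m²)^{−1} and Σ^ε, Σ₁^ε, Σ₂^ε are given by amputated, one-particle-irreducible graphs of the expansion of G^ε."*

WHAT IS PROVED (theorems only; no `Prop` fact, no `sorry`; standard axioms).  With `m T := numSep T.G T.legIn.1 T.legOut.1`
(written out; the number of internal lines of the insertion `T` separating its in-leg from its out-leg):
* `numSep_glue2`: `m (glue2 T₁ T₂) = m T₁ + m T₂ + 1` for connected pieces;
* **`numSep_chain`**: `m (chain T l) = m T + (l.map m).sum + l.length` when every piece is connected;
* **`numSep_chain_of_proper`**: if every piece is PROPER (p37's `IsProper`, equivalently `m = 0` by `isProper_iff_numSep_eq_zero`)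
  then `m (chain T l) = l.length` — a chain of `r + 1` proper insertions is a connected two-leg graph with exactly `r` separating
  lines, i.e. its chain decomposition (`B3OnePIChainDecomposition`/`Pieces`) has `r + 1` pieces: analysis ∘ synthesis returns
  the length;
* `level_ports_chain_of_proper` (in-leg vertex at level 0, out-leg vertex at level `l.length`);
* `numSep_chain_pic1_pic1`: the displayed `n = 2` term ①—C₀^ε—① has exactly one separating line.
HONEST SCOPE.  Counting statement only; the identification of the `k`-th piece `V_k` of the decomposition with the vertex block of
the `k`-th list entry is `level_glue_left`/`level_glue_right` iterated and is not spelled out here; nothing analytic.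
-/

namespace Literature.MathematicalPhysics.QuantumFieldTheory.Balaban1983to89.B3OnePIChainGlueCount

open Relation Finset B3Prop1 B3Cor23Concrete B3OnePIGraphs B3OnePIChainDecomposition B3OnePIChainPieces B3GraphGlueLegs
  B3GraphGlue B3OnePIChainGlueLevels B3OnePIChainGlue

variable {nbar : ℕ}

/-- **gluing two connected insertions adds their separating lines plus the new one**:
`numSep (glue2 T₁ T₂) = numSep T₁ + numSep T₂ + 1` between in-leg and out-leg. [cite: Balaban1983Higgs3, (1.21) p.416] -/
theorem numSep_glue2 (T₁ T₂ : TwoLegGraph nbar) (h₁ : IsConnected T₁.G) (h₂ : IsConnected T₂.G) :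
    numSep (glue2 T₁ T₂).G (glue2 T₁ T₂).legIn.1 (glue2 T₁ T₂).legOut.1 =
      numSep T₁.G T₁.legIn.1 T₁.legOut.1 + numSep T₂.G T₂.legIn.1 T₂.legOut.1 + 1 :=
  numSep_glue (ha := T₁.out_ext) (hb := T₂.in_ext) (hab := out_isLeft_eq_in_isLeft T₁ T₂) T₁.legIn.1 T₂.legOut.1 h₁ h₂

/-- **the separating lines of a chain of connected insertions**: those of the pieces plus one per glue line —
`numSep (chain T l) = numSep T + Σ_{T' ∈ l} numSep T' + l.length`. [cite: Balaban1983Higgs3, (1.21) p.416] -/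
theorem numSep_chain (T : TwoLegGraph nbar) (l : List (TwoLegGraph nbar)) (hT : IsConnected T.G)
    (hl : ∀ T' ∈ l, IsConnected T'.G) :
    numSep (chain T l).G (chain T l).legIn.1 (chain T l).legOut.1 =
      numSep T.G T.legIn.1 T.legOut.1 + (l.map fun T' => numSep T'.G T'.legIn.1 T'.legOut.1).sum + l.length := by
  induction l generalizing T with
  | nil => simp
  | cons T' l ih =>
      have hT' : IsConnected T'.G := hl T' (by simp)
      have hl' : ∀ T'' ∈ l, IsConnected T''.G := fun T'' h => hl T'' (by simp [h])
      rw [chain_cons, numSep_glue2 T (chain T' l) hT (isConnected_chain hT' hl'), ih T' hT' hl']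
      simp only [List.map_cons, List.sum_cons, List.length_cons]
      omega

/-- **a chain of `r + 1` PROPER insertions has exactly `r` separating lines** (the glue lines): with every piece connected and
proper in p37's sense (no internal line separates two external legs), `numSep (chain T l) = l.length` — the chain decomposition of
the glued graph has `l.length + 1` pieces, one per list entry. [cite: Balaban1983Higgs3, (1.21) p.416] -/
theorem numSep_chain_of_proper (T : TwoLegGraph nbar) (l : List (TwoLegGraph nbar)) (hT : IsProper T.G)
    (hl : ∀ T' ∈ l, IsProper T'.G) :
    numSep (chain T l).G (chain T l).legIn.1 (chain T l).legOut.1 = l.length := by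
  have h0 : ∀ T' : TwoLegGraph nbar, IsProper T'.G → numSep T'.G T'.legIn.1 T'.legOut.1 = 0 := fun T' hP =>
    (isProper_iff_numSep_eq_zero hP.isConnected).1 hP T'.legIn T'.legOut T'.in_ext T'.out_ext
  rw [numSep_chain T l hT.isConnected (fun T' h => (hl T' h).isConnected), h0 T hT]
  have hsum : (l.map fun T' => numSep T'.G T'.legIn.1 T'.legOut.1).sum = 0 := by
    apply List.sum_eq_zero
    intro m hm
    obtain ⟨T', hT', rfl⟩ := List.mem_map.1 hm
    exact h0 T' (hl T' hT')
  rw [hsum]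
  simp

/-- kernel: in a chain of proper insertions the in-leg vertex has level `0` and the out-leg vertex has level `l.length` — the
chain decomposition of `B3OnePIChainDecomposition` runs through all `l.length + 1` pieces. [cite: Balaban1983Higgs3, (1.21) p.416] -/
theorem level_ports_chain_of_proper (T : TwoLegGraph nbar) (l : List (TwoLegGraph nbar)) (hT : IsProper T.G)
    (hl : ∀ T' ∈ l, IsProper T'.G) :
    level (chain T l).G (chain T l).legIn.1 (chain T l).legOut.1 (chain T l).legIn.1 = 0 ∧
    level (chain T l).G (chain T l).legIn.1 (chain T l).legOut.1 (chain T l).legOut.1 = l.length := by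
  refine ⟨level_left, ?_⟩
  rw [level_right, numSep_chain_of_proper T l hT hl]

/-- **the displayed `n = 2` term ①—C₀^ε—① of (1.21)** (p37's `chain (pic1 n̄) [pic1 n̄]`, ① = the φ-tadpole (1.22)① = p18's `g36c`):
exactly ONE line separates its two external legs — the glue line `C₀^ε`. [cite: Balaban1983Higgs3, (1.22) p.416] -/
theorem numSep_chain_pic1_pic1 :
    numSep (chain (pic1 nbar) [pic1 nbar]).G (chain (pic1 nbar) [pic1 nbar]).legIn.1
      (chain (pic1 nbar) [pic1 nbar]).legOut.1 = 1 := by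
  have hP : IsProper (pic1 nbar).G := (isOnePI_of_nV_eq_one rfl).isProper
  simpa using numSep_chain_of_proper (pic1 nbar) [pic1 nbar] hP (fun T' h => by simp at h; rw [h]; exact hP)

end Literature.MathematicalPhysics.QuantumFieldTheory.Balaban1983to89.B3OnePIChainGlueCount
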